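import Summits.Ventures.Crystal3D.StickySpheres.FccAllN
import Summits.Ventures.Crystal3D.Bulk.BulkOfGapComputational
import Summits.Ventures.Crystal3D.Bulk.GapLadderComputational
import HarnessLib

/-!
# Bulk crystallization constants from the fcc bound with constant `10`: `K = 130` (and `240`, `20`)

HONEST FRAMING. Part of the venture `Summits/Ventures/Crystal3D` (cell `pub-crystal3d`, phase 2; seat p3
g11). PURE RE-INSTANTIATION of the cell's counting chain (`Bulk/DefectCounting.lean`,
`Bulk/SharperConstant.lean`, `Bulk/GapReductionSharp.lean`, `Bulk/BulkOfGapComputational.lean`) with the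
all-`N` fcc lower bound `six_mul_sub_ten_mul_rpow_le_maxContacts : 6N − 10·N^{2/3} ≤ C(N)`
(`StickySpheres/FccAllN.lean`) in place of the crude `6N − 54·N^{2/3} ≤ C(N)`: every constant is divided
by `5.4` — `108 → 20` (unsaturated balls), `1296 → 240` (saturated core), `702 → 130` (all-but-one rule,
`13 · 10`). The hypotheses of each implication are EXACTLY those of its `702`/`1296` namesake (same
named facts, same grades: the `_of_twelveNeighbourGap` / `_of_flyspeck_L12` forms inherit the
computational grade of `kissingClassification_two_mul_hales_h0_holds`; the `_of_classification` forms are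
on the standard axioms). Also the K-path consumer at `h = 5/4`: `bulkCrystallization3D_130_of_kissingClassification_250 :
KissingClassification (5/2) → BulkCrystallization3D 130` (GAP side = tree `gapTupleDiam_125`, computational grade). NO new
crystallization claim: `BulkCrystallization3D 130` is asserted only under
the hypotheses displayed, and GAP(1.26) / the census are NOT claimed here.
-/

noncomputable section

open Finset

namespace Summit.Ventures.Crystal3D

open Literature.Geometry.DiscreteGeometry

variable {N : ℕ} {x : Fin N → EuclideanSpace ℝ (Fin 3)}

/-- A sticky ground state of `N` balls misses at most `10·N^{2/3}` contacts from six per ball: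
`6N − C(x) ≤ 10·N^{2/3}`. -/
theorem IsStickyGroundState.six_mul_sub_numContacts_le_ten (hx : IsStickyGroundState x) :
    6 * (N : ℝ) - numContacts x ≤ 10 * (N : ℝ) ^ ((2 : ℝ) / 3) := by
  have h := six_mul_sub_ten_mul_rpow_le_maxContacts N
  rw [← hx.2] at h
  linarith

/-- **All but `20·N^{2/3}` balls of a sticky ground state have twelve contacts** (was `108`).
Unconditional. -/
theorem IsStickyGroundState.card_coordination_lt_twelve_le_twenty (hx : IsStickyGroundState x) :
    ((univ.filter fun i => coordination x i < 12).card : ℝ) ≤ 20 * (N : ℝ) ^ ((2 : ℝ) / 3) := by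
  have h1 : ((univ.filter fun i => coordination x i < 12).card : ℝ) + 2 * numContacts x ≤
      12 * N := by
    exact_mod_cast card_coordination_lt_twelve_add_le hx.1
  have h2 := hx.six_mul_sub_numContacts_le_ten
  linarith

/-- **Set form, one unsaturated neighbour, `K = 240`** (was `1296`): in a sticky ground state a set
each of whose saturated members has an unsaturated contact neighbour has `≤ 240·N^{2/3}` members. -/
theorem IsStickyGroundState.card_le_of_unsaturated_neighbor_240 (hx : IsStickyGroundState x)
    {D : Finset (Fin N)}
    (hD : ∀ i ∈ D, coordination x i = 12 → ∃ j ∈ contactNeighbors x i, coordination x j ≠ 12) :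
    (D.card : ℝ) ≤ 240 * (N : ℝ) ^ ((2 : ℝ) / 3) := by
  have h1 := card_le_mul_sub_of_unsaturated_neighbor hx.1 hD
  have h2 := hx.six_mul_sub_numContacts_le_ten
  linarith

/-- **All but `240·N^{2/3}` balls of a sticky ground state lie in the saturated core** (twelve
contacts, and all contact neighbours with twelve contacts; was `1296`). Unconditional. -/
theorem IsStickyGroundState.card_not_saturatedCore_le_240 (hx : IsStickyGroundState x) :
    ((univ.filter fun i => ¬ (coordination x i = 12 ∧
        ∀ j ∈ contactNeighbors x i, coordination x j = 12)).card : ℝ) ≤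
      240 * (N : ℝ) ^ ((2 : ℝ) / 3) := by
  classical
  refine hx.card_le_of_unsaturated_neighbor_240 fun i hi h12 => ?_
  have h := (mem_filter.1 hi).2
  by_contra hne
  push Not at hne
  exact h ⟨h12, fun j hj => by by_contra hj12; exact absurd (hne j hj) hj12⟩

/-- **Set form, two unsaturated neighbours, `K = 130 = 13 · 10`** (was `702`). -/
theorem IsStickyGroundState.card_le_of_two_unsaturated_neighbors_130 (hx : IsStickyGroundState x)
    {D : Finset (Fin N)}
    (hD : ∀ i ∈ D, coordination x i = 12 → ∃ j ∈ contactNeighbors x i, ∃ j' ∈ contactNeighbors x i,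
      j ≠ j' ∧ coordination x j ≠ 12 ∧ coordination x j' ≠ 12) :
    (D.card : ℝ) ≤ 130 * (N : ℝ) ^ ((2 : ℝ) / 3) := by
  have h1 : 2 * (D.card : ℝ) + 26 * numContacts x ≤ 156 * N := by
    exact_mod_cast two_mul_card_add_le_of_two_unsaturated_neighbors hx.1 hD
  have h2 := hx.six_mul_sub_numContacts_le_ten
  linarith

/-- **Reduction schema, all-but-one rule, `K = 130`.** If in every finite unit packing of `ℝ³` a ball
with twelve contacts, all of whose contact neighbours except possibly one have twelve contacts, is good,
then in every sticky ground state all but `≤ 130·N^{2/3}` balls are good. -/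
theorem almostAll_of_localRule_allButOne_130
    (Good : ∀ {M : ℕ}, (Fin M → EuclideanSpace ℝ (Fin 3)) → Fin M → Prop)
    (hrule : ∀ {M : ℕ} (y : Fin M → EuclideanSpace ℝ (Fin 3)), IsUnitPacking y →
      ∀ i (j₀ : Fin M), coordination y i = 12 →
        (∀ j ∈ contactNeighbors y i, j ≠ j₀ → coordination y j = 12) → Good y i)
    (hx : IsStickyGroundState x) [DecidablePred (Good x)] :
    ((univ.filter fun i => ¬ Good x i).card : ℝ) ≤ 130 * (N : ℝ) ^ ((2 : ℝ) / 3) := by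
  have h1 : 2 * ((univ.filter fun i => ¬ Good x i).card : ℝ) + 26 * numContacts x ≤ 156 * N := by
    exact_mod_cast two_mul_card_not_add_le_of_localRule_allButOne hx.1 (Good x) (hrule x hx.1)
  have h2 := hx.six_mul_sub_numContacts_le_ten
  linarith

/-- **GAP(δ) ∧ CLASSIFICATION(δ) ⇒ bulk crystallization with `K = 130`** (standard axioms; was `702`):
in every sticky ground state of `N` unit balls in `ℝ³` all but at most `130·N^{2/3}` balls have an fcc
(cuboctahedral) or hcp (anticuboctahedral) contact shell. -/
theorem bulkCrystallization3D_130_of_gap_of_classification {δ : ℝ} (hg : KissingGap δ)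
    (hc : KissingClassification δ) : BulkCrystallization3D 130 := fun _N _x hx =>
  hx.card_le_of_two_unsaturated_neighbors_130 fun _i hi h12 =>
    two_unsaturated_of_not_isClosePackedShell_of_gap hg hc hx.1 h12 (mem_nonClosePacked.1 hi)

/-- **The same from the fourteen-ball form** `GapTupleDiam d₀` and a classification at gap `2d₀`
(the K-path of record at `d₀ = 1.25`: `gapTupleDiam_125` + `KissingClassification (5/2)`). -/
theorem bulkCrystallization3D_130_of_gapTupleDiam_of_classification {d₀ : ℝ}
    (hg : GapTupleDiam d₀) (hc : KissingClassification (2 * d₀)) : BulkCrystallization3D 130 :=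
  bulkCrystallization3D_130_of_gap_of_classification
    (kissingGap_of_gapTuple ((gapTupleDiam_iff d₀).1 hg)) hc

/-- **GAP(1.26) ⇒ bulk crystallization, `K = 130`** (computational grade on the classification side:
`kissingClassification_two_mul_hales_h0_holds`; was `702`). -/
theorem bulkCrystallization3D_130_of_twelveNeighbourGap (h : TwelveNeighbourGap hales_h0) :
    BulkCrystallization3D 130 :=
  bulkCrystallization3D_130_of_gap_of_classification (kissingGap_of_twelveNeighbourGap h)
    kissingClassification_two_mul_hales_h0_holds

/-- **The same from `GapTupleDiam 1.26`.** -/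
theorem bulkCrystallization3D_130_of_gapTupleDiam_hales_h0 (h : GapTupleDiam hales_h0) :
    BulkCrystallization3D 130 :=
  bulkCrystallization3D_130_of_twelveNeighbourGap (twelveNeighbourGap_of_gapTupleDiam h)

/-- **Flyspeck-conditional bulk crystallization with `K = 130`** (trust base {`flyspeck_L12`} + the
classification run's `native_decide` axioms; was `702`). -/
theorem bulkCrystallization3D_130_of_flyspeck_L12 (hL12 : flyspeck_L12) :
    BulkCrystallization3D 130 :=
  bulkCrystallization3D_130_of_twelveNeighbourGap (twelveNeighbourGap_of_L12 hL12)

/-- **`K = 130` from Hales's two named facts** (`flyspeck_L12`, `Hales2012_kissingConfigCongruent`) as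
hypotheses — standard axioms (was `702`). -/
theorem bulkCrystallization3D_130_of_L12_of_kissingConfigCongruent (hL12 : flyspeck_L12)
    (hcl : Hales2012_kissingConfigCongruent) : BulkCrystallization3D 130 := fun _N _x hx =>
  hx.card_le_of_two_unsaturated_neighbors_130 fun _i hi h12 =>
    two_unsaturated_of_not_isClosePackedShell hL12 hcl hx.1 h12 (mem_nonClosePacked.1 hi)

/-- **K-path at `h = 5/4` with `K = 130`**: if every `5/2`-gap kissing configuration is fcc or hcp
(`KissingClassification (5/2)`, BIMODAL(1.25) — NOT a theorem of the tree at the time of writing), then every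
sticky-sphere ground state on `N` balls has all but `≤ 130·N^{2/3}` balls with an fcc or hcp contact shell; the
GAP side is the tree theorem `gapTupleDiam_125 : GapTupleDiam 1.25` (computational grade: standard axioms + the 67
compiled interval evaluations of `CapX2.noHole_0625`). Mirror of `bulkCrystallization3D_sharp_of_kissingClassification_250`
(`Bulk/BulkOfGap125.lean`, `K = 702`). -/
theorem bulkCrystallization3D_130_of_kissingClassification_250 (hc : KissingClassification (5 / 2)) :
    BulkCrystallization3D 130 :=
  bulkCrystallization3D_130_of_gapTupleDiam_of_classification gapTupleDiam_125
    (by rw [show (2 : ℝ) * 1.25 = 5 / 2 by norm_num]; exact hc)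

end Summit.Ventures.Crystal3D

end
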